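import Literature.Combinatorics.SimpleGraph.HamiltonianLOTLayout
import Literature.Combinatorics.SimpleGraph.HamiltonianDiamondLadder
import Literature.Combinatorics.SimpleGraph.HamiltonianRailPlacement
import Literature.Combinatorics.SimpleGraph.HamiltonianRailGadgets
import HarnessLib

/-!
# The `#3SAT → #HamPath` construction, II: placed gadgets and the stage-1 family

Continuation of `HamiltonianLOTLayout.lean`. The graph of a CNF `φ` is the diamond chain with
`M φ` cells (`HamiltonianDiamondChain.lean`) with two families of gadgets substituted
(`HamiltonianIteratedSubstitution.lean`). This file packages placed gadgets uniformly and builds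
the first family:

* `Placed` — a placed gadget: graph, block `[lo, lo + size)` of inner vertices, slots (ends below
  the block, pairwise vertex-disjoint), the inner slot edges `H` it offers to later
  gadgets, the hypotheses of the substitution theorem, and its refined census in the form
  `coverCountRF GX VX U RX (H \ RX) = [spec U RX]` (`U ⊆ S`, `RX ⊆ H`); constructors
  `Placed.ofXOR`, `Placed.ofOR1`, `Placed.ofOR3` (rail placements, `H = ∅`) and `Placed.ofDL`
  (diamond-ladder placements, `H` = the eight hop edges);
* **stage 1** (`placed₁ φ i`, `i < n₁ φ`; `fam₁ φ`): the diamond ladder `DL(r, j)` on `(Bl.UR, Br.UL)`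
  at every site (`i = r N + j < N²`), the one-input OR pins on the `2N` dummy cells
  (`N² ≤ i < N² + 2N`, pin on `(i - N²).UL`), the unit-clause gadget on `litSlot 0` (`i = N² + 2N`)
  and a three-input OR-gadget on `litSlot (3t+1), litSlot (3t+2), litSlot (3t+3)`
  (`i = N² + 2N + 1 + t`);
* `valid₁` — **the stage-1 family is valid** over the diamond chain (`GadgetFamily.Valid`).

Stage 2 and the counting are parts IIb and IV.

## References

* M. Liśkiewicz, M. Ogihara, S. Toda, TCS 304 (2003) 129–156, §3 (Lemma 4, Figs. 2, 4, 5).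
* M. R. Garey, D. S. Johnson, *Computers and Intractability*, Freeman 1979, §3.2.2.
-/

namespace Literature.Combinatorics.SimpleGraph

/-! ### Placed gadgets, uniformly packaged -/

open Classical in
/-- **A placed gadget** with the hypotheses of the substitution theorem and its refined census.
[cite: GareyJohnson1979, §3.2.2 (local replacement by a copy of the gadget)] -/
structure Placed where
  /-- the gadget graph -/
  GX : _root_.SimpleGraph ℕ
  /-- the inner vertices -/
  VX : Finset ℕ
  /-- the slots -/
  S : Finset (ℕ × ℕ)
  /-- inner slot edges offered to later stages -/
  H : Finset (ℕ × ℕ)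
  /-- first inner vertex -/
  lo : ℕ
  /-- number of inner vertices -/
  size : ℕ
  /-- census specification -/
  spec : Finset (ℕ × ℕ) → Finset (ℕ × ℕ) → Prop
  /-- the inner vertices are the block -/
  mem_VX_iff : ∀ v, v ∈ VX ↔ lo ≤ v ∧ v < lo + size
  /-- slot ends lie below the block -/
  slot_lt : ∀ e ∈ S, e.1 < lo ∧ e.2 < lo
  /-- offered edges are inner edges of the gadget -/
  H_inner : ∀ x ∈ H, x.1 ∈ VX ∧ x.2 ∈ VX ∧ GX.Adj x.1 x.2
  /-- gadget edges attach to ports only -/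
  gadget_adj : ∀ a b, GX.Adj a b → (a ∈ VX ∨ b ∈ VX) ∧ (a ∈ VX ∨ a ∈ ports S) ∧ (b ∈ VX ∨ b ∈ ports S)
  /-- one port edge at each port -/
  port_unique : ∀ p ∈ ports S, ∀ x y, GX.Adj p x → GX.Adj p y → x = y
  /-- distinct slots have no common end -/
  slot_disjoint : ∀ e ∈ S, ∀ e' ∈ S, e ≠ e' → e.1 ≠ e'.1 ∧ e.1 ≠ e'.2 ∧ e.2 ≠ e'.1 ∧ e.2 ≠ e'.2
  /-- exclusivity -/
  exclusive : Exclusive GX VX S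
  /-- the refined census -/
  census : ∀ U ⊆ S, ∀ RX ⊆ H, coverCountRF GX VX U RX (H \ RX) = if spec U RX then 1 else 0

namespace Placed

/-- **The empty gadget** (for indices off the range; its only cover is the empty family). [folklore] -/
def empty (lo : ℕ) : Placed where
  GX := ⊥
  VX := ∅
  S := ∅
  H := ∅
  lo := lo
  size := 0
  spec := fun _ _ => True
  mem_VX_iff := fun v => by simp
  slot_lt := fun e he => by simp at he
  H_inner := fun x hx => by simp at hx
  gadget_adj := fun a b h => by simp at h
  port_unique := fun p hp => by simp [ports] at hp
  slot_disjoint := fun e he => by simp at he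
  exclusive := fun T hT _ _ _ τ hτ => by
    have := (hT τ hτ).1
    simp [ports] at this
  census := fun U hU RX hRX => by
    have hU0 : U = ∅ := Finset.subset_empty.1 hU
    have hR0 : RX = ∅ := Finset.subset_empty.1 hRX
    subst hU0; subst hR0
    rw [if_pos trivial, coverCountRF, Finset.sdiff_self]
    have : coverSetRF (⊥ : _root_.SimpleGraph ℕ) ∅ ∅ ∅ ∅ = {fun _ => []} := by
      ext f
      simp only [coverSetRF, IsCover, Set.mem_setOf_eq, Set.mem_singleton_iff, Finset.notMem_empty,
        false_imp_iff, imp_true_iff, true_and, and_true, not_false_eq_true, forall_const]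
      constructor
      · intro h; funext e; exact h e
      · rintro rfl e; rfl
    rw [this, Set.ncard_singleton]

variable (G : Placed)

/-- Slot ends lie below the block. [folklore] -/
theorem slot_fst_lt {e : ℕ × ℕ} (he : e ∈ G.S) : e.1 < G.lo := (G.slot_lt e he).1

/-- Ports lie below the block. [folklore] -/
theorem port_lt {p : ℕ} (hp : p ∈ ports G.S) : p < G.lo := by
  obtain ⟨e, he, rfl | rfl⟩ := mem_ports_iff.1 hp
  exacts [G.slot_fst_lt he, (G.slot_lt e he).2]

/-- Inner vertices lie in the block. [folklore] -/
theorem lo_le_of_mem {v : ℕ} (hv : v ∈ G.VX) : G.lo ≤ v ∧ v < G.lo + G.size := (G.mem_VX_iff v).1 hv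

/-- Ports are not inner. [folklore] -/
theorem port_not_mem {p : ℕ} (hp : p ∈ ports G.S) : p ∉ G.VX := fun h =>
  absurd (G.lo_le_of_mem h).1 (not_le.2 (G.port_lt hp))

/-- Both ends of a gadget edge lie below the end of the block. [folklore] -/
theorem lt_of_adj {a b : ℕ} (h : G.GX.Adj a b) : a < G.lo + G.size ∧ b < G.lo + G.size := by
  obtain ⟨-, ha, hb⟩ := G.gadget_adj a b h
  constructor
  · rcases ha with ha | ha
    · exact (G.lo_le_of_mem ha).2
    · exact (G.port_lt ha).trans_le (Nat.le_add_right _ _)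
  · rcases hb with hb | hb
    · exact (G.lo_le_of_mem hb).2
    · exact (G.port_lt hb).trans_le (Nat.le_add_right _ _)

/-- A gadget edge has an inner end, hence an end `≥ lo`. [folklore] -/
theorem lo_le_of_adj {a b : ℕ} (h : G.GX.Adj a b) : G.lo ≤ a ∨ G.lo ≤ b := by
  obtain ⟨hab, -, -⟩ := G.gadget_adj a b h
  rcases hab with ha | hb
  · exact Or.inl (G.lo_le_of_mem ha).1
  · exact Or.inr (G.lo_le_of_mem hb).1

end Placed

/-! ### Rail placements, packaged -/

section rail

/-- **The inner vertices of a rail placement are exactly its block.** [folklore] -/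
theorem RailPlacement.mem_VX_iff' (P : RailPlacement) (hK : 0 < P.K) (v : ℕ) :
    v ∈ P.VX ↔ P.base ≤ v ∧ v < P.base + (P.k * P.K + P.m) := by
  refine ⟨P.mem_VX_bounds, fun ⟨h1, h2⟩ => ?_⟩
  by_cases hn : v < P.base + P.k * P.K
  · -- a rail node
    set d := v - P.base with hd
    have hdlt : d < P.k * P.K := by omega
    have hq : d / P.K < P.k := Nat.div_lt_of_lt_mul (by rwa [Nat.mul_comm] at hdlt)
    have hr : d % P.K < P.K := Nat.mod_lt _ hK
    have := P.emb_mem_VX (w := RailV.node (⟨d / P.K, hq⟩, ⟨d % P.K, hr⟩)) rfl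
    rw [RailPlacement.emb_apply] at this
    simp only [RailPlacement.embFun] at this
    convert this using 1
    have := Nat.div_add_mod d P.K
    rw [Nat.mul_comm] at this
    omega
  · -- a midpoint
    have hm : v - (P.base + P.k * P.K) < P.m := by omega
    have := P.emb_mem_VX (w := RailV.mid ⟨v - (P.base + P.k * P.K), hm⟩) rfl
    rw [RailPlacement.emb_apply] at this
    simp only [RailPlacement.embFun] at this
    convert this using 1
    omega

/-- The slots of a rail placement have pairwise distinct ends. [folklore] -/
theorem RailPlacement.slot_disjoint' (P : RailPlacement) :
    ∀ e ∈ P.S, ∀ e' ∈ P.S, e ≠ e' → e.1 ≠ e'.1 ∧ e.1 ≠ e'.2 ∧ e.2 ≠ e'.1 ∧ e.2 ≠ e'.2 := by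
  intro e he e' he' hne
  obtain ⟨r, rfl⟩ := P.mem_S_iff.1 he
  obtain ⟨r', rfl⟩ := P.mem_S_iff.1 he'
  exact P.ends_distinct r r' fun h => hne (by rw [h])

/-- Cardinality of an image of rails under `ends`. [folklore] -/
theorem RailPlacement.card_image_ends (P : RailPlacement) (U₀ : Finset (Fin P.k)) :
    (U₀.image P.ends).card = U₀.card :=
  Finset.card_image_of_injective _ fun r r' h => by
    by_contra hne
    exact (P.ends_distinct r r' hne).1 (by rw [h])

/-- Cardinality of an image of rails under the template's `slot`. [folklore] -/
theorem RailPlacement.card_image_slot (P : RailPlacement) (U₀ : Finset (Fin P.k)) :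
    (U₀.image P.Γ.slot).card = U₀.card :=
  Finset.card_image_of_injective _ P.Γ.slot_injective

/-- `ends` images of sets of rails: empty iff the set is. [folklore] -/
theorem RailPlacement.image_ends_eq_empty (P : RailPlacement) (U₀ : Finset (Fin P.k)) :
    U₀.image P.ends = ∅ ↔ U₀ = ∅ := Finset.image_eq_empty

/-- **Packaging a rail placement** of an exclusive template whose census is given by a predicate on
the number of entered rails (`XOR`: `= 1`; `OR`: `≠ 0`). [cite: GareyJohnson1979, §3.2.2] -/
def Placed.ofRail (P : RailPlacement) (hK : 0 < P.K) (hE : Exclusive P.Γ.graph P.Γ.VX P.Γ.slots)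
    (good : ℕ → Prop) [DecidablePred good]
    (hcensus : ∀ U₀ : Finset (Fin P.k), coverCount P.Γ.graph P.Γ.VX (U₀.image P.Γ.slot) = if good U₀.card then 1 else 0) :
    Placed where
  GX := P.GX
  VX := P.VX
  S := P.S
  H := ∅
  lo := P.base
  size := P.k * P.K + P.m
  spec := fun U _ => good U.card
  mem_VX_iff := P.mem_VX_iff' hK
  slot_lt := fun e he => by
    obtain ⟨r, rfl⟩ := P.mem_S_iff.1 he
    exact P.ends_lt r
  H_inner := fun x hx => by simp at hx
  gadget_adj := P.gadget_adj
  port_unique := P.port_unique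
  slot_disjoint := P.slot_disjoint'
  exclusive := P.exclusive hE
  census := fun U hU RX hRX => by
    have hR0 : RX = ∅ := Finset.subset_empty.1 hRX
    subst hR0
    obtain ⟨U₀, rfl⟩ := P.exists_eq_image_ends hU
    rw [Finset.sdiff_self, coverCountRF_empty, P.coverCount_image, hcensus, P.card_image_ends]
    split_ifs <;> rfl

end rail

/-! ### The three rail templates used, packaged -/

/-- The census of the exclusive-or ladder as a function of the number of entered rails. [cite: LiskiewiczOgiharaToda2003, §3] -/
theorem xor_census (U₀ : Finset (Fin 2)) :
    coverCount RailXOR.Γ.graph RailXOR.Γ.VX (U₀.image RailXOR.Γ.slot) = if U₀.card = 1 then 1 else 0 := by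
  rw [RailXOR.coverCount_eq _ (Finset.image_subset_iff.2 fun r _ => RailXOR.Γ.mem_slots_iff.2 ⟨r, rfl⟩),
    Finset.card_image_of_injective _ RailXOR.Γ.slot_injective]

/-- The census of the one-input OR as a function of the number of entered rails. [cite: LiskiewiczOgiharaToda2003, §3] -/
theorem or1_census (U₀ : Finset (Fin 1)) :
    coverCount RailOR1.Γ.graph RailOR1.Γ.VX (U₀.image RailOR1.Γ.slot) = if U₀.card ≠ 0 then 1 else 0 := by
  rw [RailOR1.coverCount_eq _ (Finset.image_subset_iff.2 fun r _ => RailOR1.Γ.mem_slots_iff.2 ⟨r, rfl⟩)]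
  by_cases h0 : U₀ = ∅
  · subst h0; simp
  · have : U₀.card ≠ 0 := by rwa [Ne, Finset.card_eq_zero]
    simp [h0, this]

/-- The census of the three-input OR as a function of the number of entered rails. [cite: LiskiewiczOgiharaToda2003, §3] -/
theorem or3_census (U₀ : Finset (Fin 3)) :
    coverCount RailOR3.Γ.graph RailOR3.Γ.VX (U₀.image RailOR3.Γ.slot) = if U₀.card ≠ 0 then 1 else 0 := by
  rw [RailOR3.coverCount_eq _ (Finset.image_subset_iff.2 fun r _ => RailOR3.Γ.mem_slots_iff.2 ⟨r, rfl⟩)]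
  by_cases h0 : U₀ = ∅
  · subst h0; simp
  · have : U₀.card ≠ 0 := by rwa [Ne, Finset.card_eq_zero]
    simp [h0, this]

/-- Placement data of an exclusive-or ladder on the slot edges `e₁, e₂` with block start `base`.
[folklore] -/
def xorPlacement (base : ℕ) (e₁ e₂ : ℕ × ℕ) (h₁ : e₁.1 < e₁.2) (h₂ : e₂.1 < e₂.2) (hb₁ : e₁.2 < base) (hb₂ : e₂.2 < base)
    (hd : e₁.1 ≠ e₂.1 ∧ e₁.1 ≠ e₂.2 ∧ e₁.2 ≠ e₂.1 ∧ e₁.2 ≠ e₂.2) : RailPlacement where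
  k := 2
  K := 4
  m := 4
  Γ := RailXOR.Γ
  base := base
  ends := fun r => if r = 0 then e₁ else e₂
  ends_lt := fun r => by
    by_cases hr : r = 0 <;> simp only [hr, if_true, if_false] <;> omega
  ends_ne := fun r => by
    by_cases hr : r = 0 <;> simp only [hr, if_true, if_false] <;> omega
  ends_distinct := fun r r' hrr' => by
    have : (r = 0 ∧ r' = 1) ∨ (r = 1 ∧ r' = 0) := by omega
    rcases this with ⟨rfl, rfl⟩ | ⟨rfl, rfl⟩
    · simpa using hd
    · simp only [↓reduceIte, one_ne_zero]
      exact ⟨fun h => hd.1 h.symm, fun h => hd.2.2.1 h.symm, fun h => hd.2.1 h.symm, fun h => hd.2.2.2 h.symm⟩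

/-- **A placed exclusive-or ladder** on the slot edges `e₁, e₂`: census `[|U| = 1]`. [cite: LiskiewiczOgiharaToda2003, §3 (XOR-gadget)] -/
def Placed.ofXOR (base : ℕ) (e₁ e₂ : ℕ × ℕ) (h₁ : e₁.1 < e₁.2) (h₂ : e₂.1 < e₂.2) (hb₁ : e₁.2 < base) (hb₂ : e₂.2 < base)
    (hd : e₁.1 ≠ e₂.1 ∧ e₁.1 ≠ e₂.2 ∧ e₁.2 ≠ e₂.1 ∧ e₁.2 ≠ e₂.2) : Placed :=
  Placed.ofRail (xorPlacement base e₁ e₂ h₁ h₂ hb₁ hb₂ hd) (by show 0 < 4; omega) RailXOR.exclusive (fun n => n = 1)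
    xor_census

/-- Placement data of a one-input OR on the slot edge `e` with block start `base`. [folklore] -/
def or1Placement (base : ℕ) (e : ℕ × ℕ) (h : e.1 < e.2) (hb : e.2 < base) : RailPlacement where
  k := 1
  K := 2
  m := 1
  Γ := RailOR1.Γ
  base := base
  ends := fun _ => e
  ends_lt := fun _ => by constructor <;> omega
  ends_ne := fun _ => by omega
  ends_distinct := fun r r' hrr' => absurd (Subsingleton.elim r r') hrr'

/-- **A placed one-input OR** on the slot edge `e`: census `[U ≠ ∅]` (the slot must be used).
[cite: LiskiewiczOgiharaToda2003, §3 (one-input OR-gadget)] -/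
def Placed.ofOR1 (base : ℕ) (e : ℕ × ℕ) (h : e.1 < e.2) (hb : e.2 < base) : Placed :=
  Placed.ofRail (or1Placement base e h hb) (by show 0 < 2; omega) RailOR1.exclusive (fun n => n ≠ 0)
    or1_census

/-- Placement data of a three-input OR on the slot edges `e r` (`r < 3`) with block start `base`.
[folklore] -/
def or3Placement (base : ℕ) (e : Fin 3 → ℕ × ℕ) (h : ∀ r, (e r).1 < (e r).2) (hb : ∀ r, (e r).2 < base)
    (hd : ∀ r r', r ≠ r' → (e r).1 ≠ (e r').1 ∧ (e r).1 ≠ (e r').2 ∧ (e r).2 ≠ (e r').1 ∧ (e r).2 ≠ (e r').2) :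
    RailPlacement where
  k := 3
  K := 6
  m := 9
  Γ := RailOR3.Γ
  base := base
  ends := e
  ends_lt := fun r => ⟨(h r).trans (hb r), hb r⟩
  ends_ne := fun r => Nat.ne_of_lt (h r)
  ends_distinct := hd

/-- **A placed three-input OR** on the slot edges `e r`: census `[U ≠ ∅]` (some slot used).
[cite: LiskiewiczOgiharaToda2003, §3 (three-input OR-gadget)] -/
def Placed.ofOR3 (base : ℕ) (e : Fin 3 → ℕ × ℕ) (h : ∀ r, (e r).1 < (e r).2) (hb : ∀ r, (e r).2 < base)
    (hd : ∀ r r', r ≠ r' → (e r).1 ≠ (e r').1 ∧ (e r).1 ≠ (e r').2 ∧ (e r).2 ≠ (e r').1 ∧ (e r).2 ≠ (e r').2) :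
    Placed :=
  Placed.ofRail (or3Placement base e h hb hd) (by show 0 < 6; omega) RailOR3.exclusive (fun n => n ≠ 0)
    or3_census

/-! ### Diamond-ladder placements, packaged -/

/-- The hop edges `UL k` are template edges (by `decide`). [folklore] -/
theorem DiamondLadder.adj_UL (k : Fin 4) :
    DiamondLadder.graph.Adj (DiamondLadder.UL k).1 (DiamondLadder.UL k).2 := by
  show DiamondLadder.adj _ _ = true
  revert k; decide

/-- The hop edges `LL k` are template edges (by `decide`). [folklore] -/
theorem DiamondLadder.adj_LL (k : Fin 4) :
    DiamondLadder.graph.Adj (DiamondLadder.LL k).1 (DiamondLadder.LL k).2 := by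
  show DiamondLadder.adj _ _ = true
  revert k; decide

/-- **The offered hop edges of a placed diamond ladder are inner edges.** [folklore] -/
theorem DLPlacement.H_inner' (P : DLPlacement) : ∀ x ∈ P.H, x.1 ∈ P.VX ∧ x.2 ∈ P.VX ∧ P.GX.Adj x.1 x.2 := by
  intro x hx
  obtain ⟨k, rfl | rfl⟩ := P.mem_H_iff.1 hx
  · have hk := k.isLt
    refine ⟨P.mem_VX_iff.2 ⟨?_, ?_⟩, P.mem_VX_iff.2 ⟨?_, ?_⟩, ?_⟩
    · show P.base ≤ P.base + (8 + 4 * k.val); omega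
    · show P.base + (8 + 4 * k.val) < P.base + 24; omega
    · show P.base ≤ P.base + (9 + 4 * k.val); omega
    · show P.base + (9 + 4 * k.val) < P.base + 24; omega
    · have h := (map_adj_iff P.emb).2 (DiamondLadder.adj_UL k)
      have e1 : (P.UL k).1 = P.emb (DiamondLadder.UL k).1 := congrArg Prod.fst (P.map_UL k).symm
      have e2 : (P.UL k).2 = P.emb (DiamondLadder.UL k).2 := congrArg Prod.snd (P.map_UL k).symm
      rw [e1, e2]; exact h
  · have hk := k.isLt
    refine ⟨P.mem_VX_iff.2 ⟨?_, ?_⟩, P.mem_VX_iff.2 ⟨?_, ?_⟩, ?_⟩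
    · show P.base ≤ P.base + (8 + 4 * k.val); omega
    · show P.base + (8 + 4 * k.val) < P.base + 24; omega
    · show P.base ≤ P.base + (10 + 4 * k.val); omega
    · show P.base + (10 + 4 * k.val) < P.base + 24; omega
    · have h := (map_adj_iff P.emb).2 (DiamondLadder.adj_LL k)
      have e1 : (P.LL k).1 = P.emb (DiamondLadder.LL k).1 := congrArg Prod.fst (P.map_LL k).symm
      have e2 : (P.LL k).2 = P.emb (DiamondLadder.LL k).2 := congrArg Prod.snd (P.map_LL k).symm
      rw [e1, e2]; exact h

/-- Placement data of a diamond ladder on the slot edges `e, f` with block start `base`. [folklore] -/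
def dlPlacement (base : ℕ) (e f : ℕ × ℕ) (he : e.1 ≠ e.2) (hf : f.1 ≠ f.2) (hbe : e.1 < base ∧ e.2 < base)
    (hbf : f.1 < base ∧ f.2 < base) (hd : e.1 ≠ f.1 ∧ e.1 ≠ f.2 ∧ e.2 ≠ f.1 ∧ e.2 ≠ f.2) : DLPlacement where
  base := base
  eT := e.1
  eF := e.2
  fT := f.1
  fF := f.2
  eT_lt := hbe.1
  eF_lt := hbe.2
  fT_lt := hbf.1
  fF_lt := hbf.2
  hne12 := he
  hne13 := hd.1
  hne14 := hd.2.1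
  hne23 := hd.2.2.1
  hne24 := hd.2.2.2
  hne34 := hf

/-- **A placed diamond ladder** on the slot edges `e, f`, offering its eight hop edges, with the
refined census `[|U| = 1 ∧ RX consistent]`. [cite: LiskiewiczOgiharaToda2003, §3, Fig. 2 (b)] -/
def Placed.ofDL (base : ℕ) (e f : ℕ × ℕ) (he : e.1 ≠ e.2) (hf : f.1 ≠ f.2) (hbe : e.1 < base ∧ e.2 < base)
    (hbf : f.1 < base ∧ f.2 < base) (hd : e.1 ≠ f.1 ∧ e.1 ≠ f.2 ∧ e.2 ≠ f.1 ∧ e.2 ≠ f.2) : Placed where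
  GX := (dlPlacement base e f he hf hbe hbf hd).GX
  VX := (dlPlacement base e f he hf hbe hbf hd).VX
  S := (dlPlacement base e f he hf hbe hbf hd).S
  H := (dlPlacement base e f he hf hbe hbf hd).H
  lo := base
  size := 24
  spec := fun U RX => U.card = 1 ∧ (dlPlacement base e f he hf hbe hbf hd).Consistent RX
  mem_VX_iff := fun v => (dlPlacement base e f he hf hbe hbf hd).mem_VX_iff
  slot_lt := fun x hx => by
    rw [(dlPlacement base e f he hf hbe hbf hd).S_eq, Finset.mem_insert, Finset.mem_singleton] at hx
    rcases hx with rfl | rfl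
    · exact hbe
    · exact hbf
  H_inner := (dlPlacement base e f he hf hbe hbf hd).H_inner'
  gadget_adj := (dlPlacement base e f he hf hbe hbf hd).gadget_adj
  port_unique := (dlPlacement base e f he hf hbe hbf hd).port_unique
  slot_disjoint := fun x hx y hy hxy => by
    rw [(dlPlacement base e f he hf hbe hbf hd).S_eq, Finset.mem_insert, Finset.mem_singleton] at hx hy
    rcases hx with rfl | rfl <;> rcases hy with rfl | rfl
    · exact absurd rfl hxy
    · exact hd
    · exact ⟨fun h => hd.1 h.symm, fun h => hd.2.2.1 h.symm, fun h => hd.2.1 h.symm, fun h => hd.2.2.2 h.symm⟩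
    · exact absurd rfl hxy
  exclusive := (dlPlacement base e f he hf hbe hbf hd).exclusive
  census := fun U hU RX hRX => by
    rw [(dlPlacement base e f he hf hbe hbf hd).coverCountRF_eq hU hRX]
    split_ifs <;> rfl

/-! ### Stage 1: the diamond ladders, the pins, the clause gadgets -/

namespace LOTReduction

open Literature.Computability.Complexity

variable (φ : CNF ℕ)

/-- Auxiliary bounds for the stage-1 placements. [folklore] -/
theorem dl_site_lt {i : ℕ} (hi : i < N φ * N φ) : i / N φ < N φ ∧ i % N φ < N φ := by
  have hN : 0 < N φ := Nat.pos_of_ne_zero fun h => by rw [h] at hi; simp at hi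
  exact ⟨Nat.div_lt_of_lt_mul hi, Nat.mod_lt _ hN⟩

/-- `5 · cell + 4 < base1` for every cell. [folklore] -/
theorem five_cell_lt_base1 {k : ℕ} (hk : k < M φ) : 5 * k + 4 < base1 φ := by unfold base1; omega

/-- The unit clause cell is a cell. [folklore] -/
theorem kIdx_zero_lt_M : kIdx φ 0 < M φ := by unfold kIdx M; omega

/-- Ends of `litSlot c` lie in `[5 K_c + 1, 5 K_c + 4]` and go up. [folklore] -/
theorem litSlot_bounds (c : ℕ) :
    5 * kIdx φ c + 1 ≤ (litSlot φ c).1 ∧ (litSlot φ c).1 < (litSlot φ c).2 ∧ (litSlot φ c).2 ≤ 5 * kIdx φ c + 4 := by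
  unfold litSlot slLL slLR
  split_ifs <;> (dsimp only; omega)

/-- Slots of distinct clause cells have pairwise distinct ends. [folklore] -/
theorem litSlot_disjoint {c c' : ℕ} (h : c ≠ c') :
    (litSlot φ c).1 ≠ (litSlot φ c').1 ∧ (litSlot φ c).1 ≠ (litSlot φ c').2 ∧
      (litSlot φ c).2 ≠ (litSlot φ c').1 ∧ (litSlot φ c).2 ≠ (litSlot φ c').2 := by
  have h1 := litSlot_bounds φ c
  have h2 := litSlot_bounds φ c'
  have hk : kIdx φ c ≠ kIdx φ c' := by unfold kIdx; omega
  rcases Nat.lt_or_gt_of_ne hk with hlt | hlt <;> (refine ⟨?_, ?_, ?_, ?_⟩ <;> omega)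

/-- **The reversed `UL` slot `(a, p)` of cell `i`**: the right rail of a diamond ladder is attached with
its top node at `a` (the outer vertex, on the column-strip boundary) and its bottom node at `p` — the
other orientation forces a crossing in the drawing (part III). [folklore] -/
def slULrev (i : ℕ) : ℕ × ℕ := (5 * i + 2, 5 * i + 1)

/-- **The stage-1 gadget with index `i`.** [cite: LiskiewiczOgiharaToda2003, §3 (Figs. 4, 5: the XOR-gadgets of the
variable cycle-pairs, the OR-gadgets of the clause blocks)] -/
noncomputable def placed₁ (i : ℕ) : Placed :=
  if h₁ : i < N φ * N φ then
    Placed.ofDL (dlBase φ (i / N φ) (i % N φ)) (slUR (blIdx φ (i / N φ) (i % N φ))) (slULrev (brIdx φ (i / N φ) (i % N φ)))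
      (by simp [slUR]) (by simp [slULrev])
      (by
        have := five_cell_lt_base1 φ (rowCell_lt_M (dl_site_lt φ h₁).1 (k := 2 * (i % N φ)) (by have := (dl_site_lt φ h₁).2; omega))
        unfold slUR blIdx dlBase; simp only; omega)
      (by
        have := five_cell_lt_base1 φ (rowCell_lt_M (dl_site_lt φ h₁).1 (k := 2 * (i % N φ) + 2) (by have := (dl_site_lt φ h₁).2; omega))
        unfold slULrev brIdx dlBase; simp only; omega)
      (by unfold slUR slULrev blIdx brIdx rowCell; simp only; omega)
  else if h₂ : i < N φ * N φ + 2 * N φ then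
    Placed.ofOR1 (pinBase φ (i - N φ * N φ)) (slUL (i - N φ * N φ)) (slUL_fst_lt _)
      (by
        have : i - N φ * N φ < M φ := by unfold M; omega
        have := five_cell_lt_base1 φ this
        unfold slUL pinBase; simp only; omega)
  else if h₃ : i = N φ * N φ + 2 * N φ then
    Placed.ofOR1 (clause1Base φ) (litSlot φ 0) (litSlot_bounds φ 0).2.1
      (by
        have := five_cell_lt_base1 φ (kIdx_zero_lt_M φ)
        have := (litSlot_bounds φ 0).2.2
        unfold clause1Base; omega)
  else if h₄ : i < n₁ φ then
    Placed.ofOR3 (or3Base φ (i - (N φ * N φ + 2 * N φ + 1)))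
      (fun r => litSlot φ (3 * (i - (N φ * N φ + 2 * N φ + 1)) + 1 + r.val))
      (fun r => (litSlot_bounds φ _).2.1)
      (fun r => by
        have ht : i - (N φ * N φ + 2 * N φ + 1) < T φ := by unfold n₁ at h₄; omega
        have hc : 3 * (i - (N φ * N φ + 2 * N φ + 1)) + 1 + r.val < N φ := by
          have := r.isLt; unfold T at ht; omega
        have := five_cell_lt_base1 φ (kIdx_lt_M hc)
        have := (litSlot_bounds φ (3 * (i - (N φ * N φ + 2 * N φ + 1)) + 1 + r.val)).2.2
        unfold or3Base clause1Base; omega)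
      (fun r r' hrr' => litSlot_disjoint φ (by have := Fin.val_ne_of_ne hrr'; omega))
  else Placed.empty (base2 φ)

/-- **The stage-1 gadget family.** [cite: LiskiewiczOgiharaToda2003, §3] -/
noncomputable def fam₁ : GadgetFamily ℕ where
  S := fun i => (placed₁ φ i).S
  GX := fun i => (placed₁ φ i).GX
  VX := fun i => (placed₁ φ i).VX

/-! ### Explicit block starts, sizes and slots of stage 1 -/

/-- The block start of stage-1 gadget `i`. [folklore] -/
def lo₁ (i : ℕ) : ℕ :=
  if i < N φ * N φ then base1 φ + 24 * i
  else if i < N φ * N φ + 2 * N φ then pinBase φ (i - N φ * N φ)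
  else if i = N φ * N φ + 2 * N φ then clause1Base φ
  else if i < n₁ φ then or3Base φ (i - (N φ * N φ + 2 * N φ + 1))
  else base2 φ

/-- The block size of stage-1 gadget `i`. [folklore] -/
def size₁ (i : ℕ) : ℕ :=
  if i < N φ * N φ then 24
  else if i < N φ * N φ + 2 * N φ then 3
  else if i = N φ * N φ + 2 * N φ then 3
  else if i < n₁ φ then 27
  else 0

/-- The slots of stage-1 gadget `i`, explicitly. [folklore] -/
def slots₁ (i : ℕ) : Finset (ℕ × ℕ) :=
  if i < N φ * N φ then {slUR (blIdx φ (i / N φ) (i % N φ)), slULrev (brIdx φ (i / N φ) (i % N φ))}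
  else if i < N φ * N φ + 2 * N φ then {slUL (i - N φ * N φ)}
  else if i = N φ * N φ + 2 * N φ then {litSlot φ 0}
  else if i < n₁ φ then
    Finset.univ.image fun r : Fin 3 => litSlot φ (3 * (i - (N φ * N φ + 2 * N φ + 1)) + 1 + r.val)
  else ∅

variable {φ}

/-- `dlBase` at site `(i / N, i % N)` is `base1 + 24 i`. [folklore] -/
theorem dlBase_div_mod (i : ℕ) : dlBase φ (i / N φ) (i % N φ) = base1 φ + 24 * i := by
  unfold dlBase
  have := Nat.div_add_mod i (N φ)
  rw [Nat.mul_comm] at this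
  omega

/-- The block start of `placed₁`. [folklore] -/
theorem placed₁_lo (i : ℕ) : (placed₁ φ i).lo = lo₁ φ i := by
  unfold placed₁ lo₁
  split_ifs <;> first | exact dlBase_div_mod i | rfl

/-- The block size of `placed₁`. [folklore] -/
theorem placed₁_size (i : ℕ) : (placed₁ φ i).size = size₁ φ i := by
  unfold placed₁ size₁
  split_ifs <;> rfl

/-- The slots of a placed exclusive-or / one-input / three-input rail gadget. [folklore] -/
theorem Placed.ofRail_S (P : RailPlacement) (hK : 0 < P.K) (hE : Exclusive P.Γ.graph P.Γ.VX P.Γ.slots)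
    (good : ℕ → Prop) [DecidablePred good]
    (hcensus : ∀ U₀ : Finset (Fin P.k), coverCount P.Γ.graph P.Γ.VX (U₀.image P.Γ.slot) = if good U₀.card then 1 else 0) :
    (Placed.ofRail P hK hE good hcensus).S = Finset.univ.image P.ends := by
  ext e
  show e ∈ P.S ↔ _
  rw [P.mem_S_iff, Finset.mem_image]
  simp only [Finset.mem_univ, true_and]
  exact ⟨fun ⟨r, h⟩ => ⟨r, h.symm⟩, fun ⟨r, h⟩ => ⟨r, h.symm⟩⟩

/-- The slots of `placed₁`. [folklore] -/
theorem placed₁_S (i : ℕ) : (placed₁ φ i).S = slots₁ φ i := by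
  unfold placed₁ slots₁
  split_ifs with h₁ h₂ h₃ h₄
  · exact (dlPlacement _ _ _ _ _ _ _ _).S_eq
  · rw [Placed.ofOR1, Placed.ofRail_S]
    ext e; simp [or1Placement]
  · rw [Placed.ofOR1, Placed.ofRail_S]
    ext e; simp [or1Placement]
  · rw [Placed.ofOR3, Placed.ofRail_S]
    rfl
  · rfl

/-- Consecutive stage-1 blocks are stacked: `lo₁ i + size₁ i ≤ lo₁ (i + 1)`. [folklore] -/
theorem lo₁_succ (i : ℕ) : lo₁ φ i + size₁ φ i ≤ lo₁ φ (i + 1) := by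
  unfold lo₁ size₁ n₁ base2 or3Base clause1Base pinBase T
  split_ifs <;> omega

/-- Block starts are at least `base1 = 5M`. [folklore] -/
theorem base1_le_lo₁ (i : ℕ) : base1 φ ≤ lo₁ φ i := by
  unfold lo₁ base2 or3Base clause1Base pinBase; split_ifs <;> omega

/-- Blocks are stacked in index order. [folklore] -/
theorem lo₁_add_size_le {i j : ℕ} (hij : i < j) : lo₁ φ i + size₁ φ i ≤ lo₁ φ j := by
  induction j with
  | zero => omega
  | succ j ih =>
    rcases Nat.lt_succ_iff_lt_or_eq.1 hij with h | rfl
    · exact (ih h).trans ((Nat.le_add_right _ _).trans (lo₁_succ j))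
    · exact lo₁_succ i

/-- The last stage-1 block ends at `base2`. [folklore] -/
theorem lo₁_add_size_le_base2 {i : ℕ} (hi : i < n₁ φ) : lo₁ φ i + size₁ φ i ≤ base2 φ := by
  have h := lo₁_add_size_le (φ := φ) hi
  unfold lo₁ at h
  have : ¬ n₁ φ < N φ * N φ := by unfold n₁; omega
  have h2 : ¬ n₁ φ < N φ * N φ + 2 * N φ := by unfold n₁; omega
  have h3 : ¬ n₁ φ = N φ * N φ + 2 * N φ := by unfold n₁; omega
  rw [if_neg this, if_neg h2, if_neg h3, if_neg (lt_irrefl _)] at h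
  exact h

/-! ### The stage-1 slots are cell slots of cells below `M`, all distinct -/

/-- **A description of every stage-1 slot**: an upper slot of a bus cell of a row, the `UL` slot
of a dummy, or the literal slot of a clause cell. [folklore] -/
inductive Slot1Kind (φ : CNF ℕ) : ℕ × ℕ → Prop
  | blUR (r j : ℕ) (hr : r < N φ) (hj : j < N φ) : Slot1Kind φ (slUR (blIdx φ r j))
  | brUL (r j : ℕ) (hr : r < N φ) (hj : j < N φ) : Slot1Kind φ (slULrev (brIdx φ r j))
  | pin (d : ℕ) (hd : d < 2 * N φ) : Slot1Kind φ (slUL d)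
  | lit (c : ℕ) (hc : c < N φ ∨ c = 0) : Slot1Kind φ (litSlot φ c)

/-- Every stage-1 slot has one of the four kinds. [folklore] -/
theorem slot1Kind_of_mem {i : ℕ} (hi : i < n₁ φ) {e : ℕ × ℕ} (he : e ∈ slots₁ φ i) : Slot1Kind φ e := by
  unfold slots₁ at he
  split_ifs at he with h₁ h₂ h₃
  · rw [Finset.mem_insert, Finset.mem_singleton] at he
    obtain ⟨hr, hj⟩ := dl_site_lt φ h₁
    rcases he with rfl | rfl
    exacts [Slot1Kind.blUR _ _ hr hj, Slot1Kind.brUL _ _ hr hj]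
  · rw [Finset.mem_singleton] at he
    subst he
    exact Slot1Kind.pin _ (by omega)
  · rw [Finset.mem_singleton] at he
    subst he
    exact Slot1Kind.lit 0 (Or.inr rfl)
  · simp only [Finset.mem_image, Finset.mem_univ, true_and] at he
    obtain ⟨r, rfl⟩ := he
    refine Slot1Kind.lit _ (Or.inl ?_)
    have := r.isLt; unfold n₁ T at hi; omega

/-- **Every stage-1 slot is a chain edge with ends in the chain.** [folklore] -/
theorem Slot1Kind.adj {e : ℕ × ℕ} (h : Slot1Kind φ e) :
    e.1 ∈ chainV (M φ) ∧ e.2 ∈ chainV (M φ) ∧ (chainG (M φ)).Adj e.1 e.2 := by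
  cases h with
  | blUR r j hr hj =>
    have hk := rowCell_lt_M hr (k := 2 * j) (by omega)
    exact ⟨(slUR_mem hk).1, (slUR_mem hk).2, chainG_adj_slUR hk⟩
  | brUL r j hr hj =>
    have hk := rowCell_lt_M hr (k := 2 * j + 2) (by omega)
    refine ⟨(slUL_mem hk).2, (slUL_mem hk).1, ?_⟩
    exact (chainG_adj_slUL hk).symm
  | pin d hd =>
    have hk : d < M φ := by unfold M; omega
    exact ⟨(slUL_mem hk).1, (slUL_mem hk).2, chainG_adj_slUL hk⟩
  | lit c hc =>
    have hk : kIdx φ c < M φ := by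
      rcases hc with hc | rfl
      · exact kIdx_lt_M hc
      · exact kIdx_zero_lt_M φ
    unfold litSlot
    split_ifs
    · exact ⟨(slLL_mem hk).1, (slLL_mem hk).2, chainG_adj_slLL hk⟩
    · exact ⟨(slLR_mem hk).1, (slLR_mem hk).2, chainG_adj_slLR hk⟩

/-- **Shapes of the stage-1 slots**: the reversal of a stage-1 slot is never a stage-1 slot (the
only decreasing slots are the reversed `UL` slots of bus cells, whose reversal is the `UL` slot of a
row cell — a pin slot has the same shape but sits on a dummy cell). [folklore] -/
theorem Slot1Kind.swap_not {e : ℕ × ℕ} (h : Slot1Kind φ e) {e' : ℕ × ℕ} (h' : Slot1Kind φ e') : e' ≠ (e.2, e.1) := by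
  intro heq
  cases h with
  | blUR r j hr hj =>
    cases h' with
    | blUR r' j' _ _ => simp [slUR, Prod.ext_iff] at heq; omega
    | brUL r' j' _ _ => simp [slUR, slULrev, Prod.ext_iff] at heq; omega
    | pin d hd => simp [slUR, slUL, Prod.ext_iff] at heq; omega
    | lit c hc => unfold litSlot at heq; split_ifs at heq <;> simp [slUR, slLL, slLR, Prod.ext_iff] at heq <;> omega
  | brUL r j hr hj =>
    cases h' with
    | blUR r' j' _ _ => simp [slUR, slULrev, Prod.ext_iff] at heq; omega
    | brUL r' j' _ _ => simp [slULrev, Prod.ext_iff] at heq; omega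
    | pin d hd =>
      have h1 := le_rowCell (φ := φ) r (2 * j + 2)
      unfold brIdx at heq
      simp [slULrev, slUL, Prod.ext_iff] at heq; omega
    | lit c hc => unfold litSlot at heq; split_ifs at heq <;> simp [slULrev, slLL, slLR, Prod.ext_iff] at heq <;> omega
  | pin d hd =>
    cases h' with
    | blUR r' j' _ _ => simp [slUR, slUL, Prod.ext_iff] at heq; omega
    | brUL r' j' _ _ =>
      have h1 := le_rowCell (φ := φ) r' (2 * j' + 2)
      unfold brIdx at heq
      simp [slULrev, slUL, Prod.ext_iff] at heq; omega
    | pin d' hd' => simp [slUL, Prod.ext_iff] at heq; omega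
    | lit c hc => unfold litSlot at heq; split_ifs at heq <;> simp [slUL, slLL, slLR, Prod.ext_iff] at heq <;> omega
  | lit c hc =>
    cases h' with
    | blUR r' j' _ _ => unfold litSlot at heq; split_ifs at heq <;> simp [slUR, slLL, slLR, Prod.ext_iff] at heq <;> omega
    | brUL r' j' _ _ => unfold litSlot at heq; split_ifs at heq <;> simp [slULrev, slLL, slLR, Prod.ext_iff] at heq <;> omega
    | pin d' hd' => unfold litSlot at heq; split_ifs at heq <;> simp [slUL, slLL, slLR, Prod.ext_iff] at heq <;> omega
    | lit c' hc' => unfold litSlot at heq; split_ifs at heq <;> simp [slLL, slLR, Prod.ext_iff] at heq <;> omega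

/-! ### Recovering the gadget from one of its slots -/

/-- The cell of a cell slot edge: `e.1 / 5`. [folklore] -/
theorem cell_of_sl (k : ℕ) :
    (slUL k).1 / 5 = k ∧ (slUR k).1 / 5 = k ∧ (slLL k).1 / 5 = k ∧ (slLR k).1 / 5 = k ∧
      (slUL k).1 % 5 = 1 ∧ (slUR k).1 % 5 = 2 ∧ (slLL k).1 % 5 = 1 ∧ (slLR k).1 % 5 = 3 ∧
      (slUL k).2 % 5 = 2 ∧ (slLL k).2 % 5 = 3 := by
  simp only [slUL, slUR, slLL, slLR]; omega

/-- The cell and shape of the reversed `UL` slot. [folklore] -/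
theorem cell_of_slULrev (k : ℕ) : (slULrev k).1 / 5 = k ∧ (slULrev k).2 % 5 = 1 ∧ (slUR k).2 % 5 = 4 := by
  simp only [slULrev, slUR]; omega

variable (φ) in
/-- The cell of a literal slot is its clause cell. [folklore] -/
theorem cell_of_litSlot (c : ℕ) : (litSlot φ c).1 / 5 = kIdx φ c := by
  unfold litSlot; split_ifs <;> simp only [slLL, slLR] <;> omega

/-- Row and position of a row cell. [folklore] -/
theorem rowCell_div_mod {r k : ℕ} (hk : k ≤ 2 * N φ) :
    (rowCell φ r k - 2 * N φ) / (2 * N φ + 1) = r ∧ (rowCell φ r k - 2 * N φ) % (2 * N φ + 1) = k := by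
  unfold rowCell rowStart
  have e : 2 * N φ + r * (2 * N φ + 1) + k - 2 * N φ = k + r * (2 * N φ + 1) := by omega
  rw [e, Nat.add_mul_div_right _ _ (by omega), Nat.add_mul_mod_self_right, Nat.div_eq_of_lt (by omega),
    Nat.mod_eq_of_lt (by omega)]
  simp

variable (φ) in
/-- **The index of the stage-1 gadget owning a slot edge** (junk off the slots). [folklore] -/
def idxOfSlot₁ (e : ℕ × ℕ) : ℕ :=
  let k := e.1 / 5
  if k < 2 * N φ then N φ * N φ + k
  else if k < 2 * N φ + N φ * (2 * N φ + 1) then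
    let r := (k - 2 * N φ) / (2 * N φ + 1)
    let pos := (k - 2 * N φ) % (2 * N φ + 1)
    if e.2 % 5 = 4 then r * N φ + pos / 2 else r * N φ + (pos / 2 - 1)
  else
    let c := k - (2 * N φ + N φ * (2 * N φ + 1))
    if c = 0 then N φ * N φ + 2 * N φ else N φ * N φ + 2 * N φ + 1 + (c - 1) / 3

/-- **A stage-1 slot determines its gadget.** [folklore] -/
theorem idxOfSlot₁_eq {i : ℕ} (hi : i < n₁ φ) {e : ℕ × ℕ} (he : e ∈ slots₁ φ i) : idxOfSlot₁ φ e = i := by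
  unfold slots₁ at he
  split_ifs at he with h₁ h₂ h₃
  · obtain ⟨hr, hj⟩ := dl_site_lt φ h₁
    have hdm := Nat.div_add_mod i (N φ)
    rw [Finset.mem_insert, Finset.mem_singleton] at he
    rcases he with rfl | rfl
    · -- `Bl.UR` of site `(i / N, i % N)`: cell `rowCell r (2 j)`
      obtain ⟨-, hc, -⟩ := cell_of_sl (blIdx φ (i / N φ) (i % N φ))
      have hm := (cell_of_slULrev (blIdx φ (i / N φ) (i % N φ))).2.2
      have hlo := le_rowCell (φ := φ) (i / N φ) (2 * (i % N φ))
      have hhi := rowCell_lt hr (k := 2 * (i % N φ)) (by omega)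
      obtain ⟨hq, hrem⟩ := rowCell_div_mod (φ := φ) (r := i / N φ) (k := 2 * (i % N φ)) (by omega)
      unfold idxOfSlot₁
      simp only [hc]
      unfold blIdx at hlo hhi hm ⊢
      rw [if_neg (by omega), if_pos hhi, if_pos hm, hq, hrem]
      rw [Nat.mul_comm] at hdm
      omega
    · -- `Br.UL` reversed: cell `rowCell r (2 j + 2)`
      obtain ⟨hc, hm, -⟩ := cell_of_slULrev (brIdx φ (i / N φ) (i % N φ))
      have hlo := le_rowCell (φ := φ) (i / N φ) (2 * (i % N φ) + 2)
      have hhi := rowCell_lt hr (k := 2 * (i % N φ) + 2) (by omega)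
      obtain ⟨hq, hrem⟩ := rowCell_div_mod (φ := φ) (r := i / N φ) (k := 2 * (i % N φ) + 2) (by omega)
      unfold idxOfSlot₁
      simp only [hc]
      unfold brIdx at hlo hhi hm ⊢
      rw [if_neg (by omega), if_pos hhi, if_neg (by omega), hq, hrem]
      rw [Nat.mul_comm] at hdm
      omega
  · rw [Finset.mem_singleton] at he
    subst he
    obtain ⟨hc, -⟩ := cell_of_sl (i - N φ * N φ)
    unfold idxOfSlot₁
    simp only [hc]
    rw [if_pos (by omega)]
    omega
  · rw [Finset.mem_singleton] at he
    subst he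
    have hc := cell_of_litSlot φ 0
    unfold idxOfSlot₁
    simp only [hc]
    unfold kIdx
    rw [if_neg (by omega), if_neg (by omega), if_pos (by omega)]
    omega
  · simp only [Finset.mem_image, Finset.mem_univ, true_and] at he
    obtain ⟨r, rfl⟩ := he
    have hc := cell_of_litSlot φ (3 * (i - (N φ * N φ + 2 * N φ + 1)) + 1 + r.val)
    have hr := r.isLt
    unfold idxOfSlot₁
    simp only [hc]
    unfold kIdx
    rw [if_neg (by omega), if_neg (by omega), if_neg (by omega)]
    unfold n₁ T at hi
    omega

/-- **Distinct stage-1 gadgets have distinct slots.** [folklore] -/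
theorem slots₁_inj {i j : ℕ} (hi : i < n₁ φ) (hj : j < n₁ φ) {e : ℕ × ℕ} (hei : e ∈ slots₁ φ i) (hej : e ∈ slots₁ φ j) :
    i = j := by
  rw [← idxOfSlot₁_eq hi hei, ← idxOfSlot₁_eq hj hej]

/-- No stage-1 slot is the reversal of a stage-1 slot. [folklore] -/
theorem swap_not_mem_slots₁ {i j : ℕ} (hi : i < n₁ φ) (hj : j < n₁ φ) {e : ℕ × ℕ} (hei : e ∈ slots₁ φ i) :
    (e.2, e.1) ∉ slots₁ φ j := fun h =>
  (slot1Kind_of_mem hi hei).swap_not (slot1Kind_of_mem hj h) rfl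

/-! ### Validity of stage 1 -/

/-- **The stage-1 family is valid over the diamond chain.** [cite: GareyJohnson1979, §3.2.2; LiskiewiczOgiharaToda2003, §3] -/
theorem valid₁ : GadgetFamily.Valid (chainG (M φ)) (chainV (M φ)) (fam₁ φ) (n₁ φ) := by
  refine ⟨fun i hi => ?_, fun i hi j hj hij => ?_, fun i hi e he => ?_, fun i hi j hj hij e he => ?_,
    fun i hi => ?_, fun i hi => ?_, fun i hi => ?_, fun i hi => ?_⟩
  · -- fresh
    rw [Finset.disjoint_left]
    intro v hv hvX
    rw [chainV, Finset.mem_range] at hv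
    have h1 := ((placed₁ φ i).lo_le_of_mem hvX).1
    rw [placed₁_lo] at h1
    have h2 := base1_le_lo₁ (φ := φ) i
    unfold base1 at h2
    omega
  · -- pairwise disjoint blocks
    rw [Finset.disjoint_left]
    intro v hvi hvj
    have h1 := (placed₁ φ i).lo_le_of_mem hvi
    have h2 := (placed₁ φ j).lo_le_of_mem hvj
    rw [placed₁_lo, placed₁_size] at h1 h2
    rcases Nat.lt_or_gt_of_ne hij with h | h
    · have := lo₁_add_size_le (φ := φ) h; omega
    · have := lo₁_add_size_le (φ := φ) h; omega
  · -- slots are chain edges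
    change e ∈ (placed₁ φ i).S at he
    rw [placed₁_S] at he
    exact (slot1Kind_of_mem hi he).adj
  · -- distinct gadgets, distinct slots
    change e ∈ (placed₁ φ i).S at he
    rw [placed₁_S] at he
    rintro (h | h) <;> change _ ∈ (placed₁ φ j).S at h <;> rw [placed₁_S] at h
    · exact hij (slots₁_inj hi hj he h)
    · exact swap_not_mem_slots₁ hi hj he h
  · exact (placed₁ φ i).slot_disjoint
  · exact (placed₁ φ i).gadget_adj
  · exact (placed₁ φ i).port_unique
  · exact (placed₁ φ i).exclusive

end LOTReduction

end Literature.Combinatorics.SimpleGraph
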